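import Summits.Ventures.QEC.CircuitDistance.PortK2InstBB144Defs
import HarnessLib

/-!
# P3-PORT (K2 instance, [[144,12,12]], sector Z): the instance CHECK (`check₂`, index data) by `decide +kernel` and `Good` (cell `qec`, experiment CDX,
# seat qec-cdx-type-1).  (A₁,A₂,A₃)=(x³,y,y²) per SI p.10 L83; (B₁,B₂,B₃)=(y³,x,x²) per print's positional convention; authors' software labelling = provenance (acq-14097 pending).
-/

namespace Summit.Ventures.QEC.CircuitDistance

open Literature.InformationTheory.QuantumCodes Finset K2

set_option maxRecDepth 100000 in
/-- The Z instance passes the kernel-cheap consistency check `check₂` against `H^X`, the translations (closure index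
tables) and the listed words (stop-witness index lists) (kernel). -/
theorem checkZ144 : instZ144.check₂ (fun j q => bb144SM.toCode.HX j q) wordsZ144 closIdxZ144 witIdxZ144 = true := by
  decide +kernel

/-- Hence the Z instance is `Good` (consistent with `H^X`, closed under translation, stop masks = translates of listed words). -/
theorem goodZ144 : instZ144.Good (fun j q => bb144SM.toCode.HX j q) wordsZ144 :=
  K2Inst.good_of_check₂ _ _ _ _ _ checkZ144

end Summit.Ventures.QEC.CircuitDistance
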